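import Literature.Analysis.FluidPDE.KNSSThm52Assembly
import Literature.Analysis.FluidPDE.KNSSRegularityAncient
import Literature.Analysis.FluidPDE.KNSSRegularityProofs
import HarnessLib

/-!
# KNSS 2009, Theorem 5.2 from the single remaining named fact (§4 on a finite window)

Analysis/FluidPDE proofs file on the decomposition path of the named facts
`Literature.Analysis.FluidPDE.KNSS2009_liouville_axisymmetric_no_swirl` (Koch–Nadirashvili–
Seregin–Šverák, Acta Math. 203 (2009) = arXiv:0709.3599, Theorem 5.2) and
`Literature.Analysis.FluidPDE.knss2009_axisymmetric_no_swirl` (its print-faithful duality-form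
rendering, `SelfSimilarLiouville`). `KNSSThm52Assembly` proves both from the two named facts
`KNSS2009_regularity_boundedWeak_ancient` (§4 on `ℝ³ × (−∞, 0)`) and
`KNSS2009_lemma21_halfball (EuclideanSpace ℝ (Fin 5))` (Lemma 2.1 in half-ball form). Meanwhile
the tree discharges the second one outright (`KNSS2009_lemma21_halfball_holds`,
`KNSSRegularityProofs`: expanding-ball barrier and comparison principle) and reduces the first to
the finite-window statement of §4 (`KNSS2009_regularity_boundedWeak_ancient_of_window`,
`KNSSRegularityAncient`). Composing, Theorem 5.2 and the corrected fact depend on the single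
named fact `KNSS2009_regularity_boundedWeak_window` (KNSS §4: Lemma 3.1, Proposition 4.1 and the
bootstrap (4.7)–(4.11) on `ℝ³ × (0, T)` — the Oseen-kernel regularity theory, not in Mathlib):

* `KNSS2009_liouville_axisymmetric_no_swirl_of_window`,
* `knss2009_axisymmetric_no_swirl_of_window`.

## References

* G. Koch, N. Nadirashvili, G. Seregin, V. Šverák, *Liouville theorems for the Navier–Stokes
  equations and applications*, Acta Math. 203 (2009) 83–105 = arXiv:0709.3599: Theorem 5.2 and
  its proof (pp. 9–10), Lemma 2.1 (p. 5), §4 (p. 8). [KochNadirashviliSereginSverak2009]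
-/

noncomputable section

namespace Literature.Analysis.FluidPDE

/-- **KNSS 2009, Theorem 5.2, from §4 on finite windows alone.** The printed Liouville theorem
for axisymmetric bounded ancient weak solutions without swirl follows from the named fact
`KNSS2009_regularity_boundedWeak_window` (KNSS §4 (4.8)–(4.11) on `ℝ³ × (0, T)`): the ancient
form of §4 is `KNSS2009_regularity_boundedWeak_ancient_of_window`, Lemma 2.1 on `ℝ⁵` is the
theorem `KNSS2009_lemma21_halfball_holds`, and `KNSS2009_liouville_axisymmetric_no_swirl_of_facts`
assembles the proof of p. 10. [cite: KochNadirashviliSereginSverak2009, Thm 5.2 (arXiv pp. 9–10) with §4 p. 8 and Lemma 2.1 p. 5] -/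
theorem KNSS2009_liouville_axisymmetric_no_swirl_of_window
    (hwin : KNSS2009_regularity_boundedWeak_window) : KNSS2009_liouville_axisymmetric_no_swirl :=
  KNSS2009_liouville_axisymmetric_no_swirl_of_facts (KNSS2009_regularity_boundedWeak_ancient_of_window hwin)
    (KNSS2009_lemma21_halfball_holds (E := EuclideanSpace ℝ (Fin 5)))

/-- **The corrected duality-form fact `knss2009_axisymmetric_no_swirl` from §4 on finite windows
alone** (through `knss2009_axisymmetric_no_swirl_of_facts`). [cite: KochNadirashviliSereginSverak2009, Thm 5.2 (arXiv pp. 9–10) with §4 p. 8 and Lemma 2.1 p. 5] -/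
theorem knss2009_axisymmetric_no_swirl_of_window
    (hwin : KNSS2009_regularity_boundedWeak_window) : knss2009_axisymmetric_no_swirl :=
  knss2009_axisymmetric_no_swirl_of_facts (KNSS2009_regularity_boundedWeak_ancient_of_window hwin)
    (KNSS2009_lemma21_halfball_holds (E := EuclideanSpace ℝ (Fin 5)))

end Literature.Analysis.FluidPDE

end
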